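import Mathlib.Topology.Covering.Basic
import Mathlib.Analysis.InnerProductSpace.PiL2
import Mathlib.Geometry.Manifold.MFDeriv.Basic
import Literature.AlgebraicGeometry.HodgeTheory.HodgeFiltrationModelsReduction
import Literature.AlgebraicGeometry.HodgeTheory.HodgeModelConnected
import HarnessLib

/-!
# Compact ball quotients: smooth complex varieties uniformised by the unit ball

Family `hodge`, layer `Literature/AlgebraicGeometry/HodgeTheory`. Requested definition
(`defn-IsCompactBallQuotient`) for route `SiuRepresentability` of the Hodge summit, whose items
`SiuTransfer`, `KaehlerRepresentable`, `BallQuotientHodge` carry the hypothesis "`X` is a compact ball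
quotient" inline; this file names it.

A **compact ball quotient** of dimension `n` is a compact complex manifold of the form `Γ \ 𝔹ⁿ`, where
`𝔹ⁿ ⊂ ℂⁿ` is the open unit ball of the hermitian norm (the bounded symmetric domain
`U(n,1)/(U(n) × U(1))`, Bergeron–Millson–Moeglin §1.1: "`X` identifies with the unit ball in `ℂᵖ`",
`S(Γ) = Γ \ X`) and `Γ ⊂ Aut(𝔹ⁿ) = PU(n,1)` is a discrete, torsion-free, cocompact group of
biholomorphisms; equivalently (the ball being simply connected, and deck transformations of a
holomorphic covering being biholomorphic) a compact complex manifold whose universal covering is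
biholomorphic to `𝔹ⁿ` (Siu's survey in the Mostow volume: the "compact Kähler surface whose universal
cover is … biholomorphic to the ball"; compact quotients of the ball are the rank-one case of the
"compact quotients of irreducible bounded symmetric domains" of Siu's strong rigidity theorem). Such
a manifold is projective (Kodaira: the Bergman metric descends to a Kähler–Einstein metric of
negative Ricci curvature, so the canonical bundle is ample).

For an `n`-dimensional smooth `ℂ`-scheme `X` the tree speaks of the complex manifold `X^an` through
**Hodge models** (`HodgeModel n X`, file `RationalHodgeClasses`: a complex manifold `A.carrier`
charted on a model space `A.model ≅ ℂⁿ` together with a comparison map exhibiting it as THE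
analytification of `X`, unique up to unique biholomorphism over `X(ℂ)` —
`HodgeModel.exists_biholomorph`, Serre GAGA §2 n°5 Prop. 2, proved in the tree). Accordingly:

* `HodgeModel.IsBallCovered A`: the Hodge model `A` admits a map `π : ℂⁿ → A.carrier`
  (`ℂⁿ = EuclideanSpace ℂ (Fin n)`, hermitian norm) which is `ℂ`-differentiable at every point of
  the open unit ball and whose restriction to the ball is a covering map (`IsCoveringMap`). Only the
  values of `π` on the ball matter; `π` is typed on all of `ℂⁿ` so that holomorphy is the elementary
  `MDifferentiableAt` on the model vector space (no manifold structure on the open subset needed).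
* `IsCompactBallQuotient n X := ∃ A : HodgeModel n X, (A is ball-covered)`, spelled out VERBATIM as
  the inline hypothesis of the route items, so that those items restate definitionally
  (`isCompactBallQuotient_iff` is `Iff.rfl`).

API (all proved): `∃`/`∀` over Hodge models agree for smooth projective `X`
(`IsCompactBallQuotient.isBallCovered`, `isCompactBallQuotient_iff_forall`: transport of a ball
covering along the biholomorphism between two models); a Hodge model exists
(`IsCompactBallQuotient.nonempty_hodgeModel`); for smooth projective `X` the covering of the
(connected, compact) carrier by the ball is surjective, hence a quotient map
(`HodgeModel.surjective_ballRestrict`, `HodgeModel.isQuotientMap_ballRestrict`), via the general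
facts `isClosed_range_of_isCoveringMap` / `surjective_of_isCoveringMap` (a covering map in Mathlib's
sense need not be surjective: its image is clopen).

## Design notes (junk analysis)

* The ball is the unit ball of `EuclideanSpace ℂ (Fin n)` (hermitian norm), NOT of `A.model` or of
  `Fin n → ℂ` (sup norm): the unit ball of the sup norm is the polydisc, which for `n ≥ 2` is not
  biholomorphic to `𝔹ⁿ` (Poincaré), and its compact quotients are a different class of varieties.
* "Compact": the predicate itself only says "uniformised by the ball"; compactness of
  `A.carrier ≃ₜ X(ℂ)` is automatic for the smooth projective `X` of the route items
  (`HodgeModel.compactSpace_carrier`), and a Hodge model records the Hodge decomposition of its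
  carrier, so the intended (and named) use is for smooth projective `X`.
* Surjectivity is NOT part of Mathlib's `IsCoveringMap` (empty fibres are allowed, the image is
  clopen). Since `𝔹ⁿ` is connected and non-empty, the bare predicate therefore says: ONE connected
  component of `X^an` is uniformised by `𝔹ⁿ`. With `Motives.IsSmoothProjective n X` (geometrically
  irreducible) the carrier is connected (`HodgeModel.connectedSpace_carrier`), so the covering is
  onto (`HodgeModel.surjective_ballRestrict`) and `A.carrier` is literally the quotient of `𝔹ⁿ` by
  the deck group (`HodgeModel.isQuotientMap_ballRestrict`).
* `n = 0`: `𝔹⁰` is a point, and `IsCompactBallQuotient 0 X` says that `X^an` has an isolated point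
  evenly covered by it — for smooth projective `X` (where `X^an` is connected): `X^an` is a point,
  the correct degenerate case (`Γ` trivial).
* What is NOT here (requested "later" by the route): the equivalence with the group-theoretic datum
  (`Γ ⊂ PU(n,1)` discrete, torsion-free, cocompact, `X^an ≅ Γ \ 𝔹ⁿ`), which needs the automorphism
  group of the ball and the biholomorphy of deck transformations; and the implication from an
  arithmetic unitary datum (Bergeron–Millson–Moeglin §1.1, `q = 1`, anisotropic hermitian form) to
  `IsCompactBallQuotient`.

## References

* N. Bergeron, J. Millson, C. Moeglin, *The Hodge conjecture and arithmetic quotients of complex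
  balls*, Acta Math. 216 (2016), §1.1 (arXiv:1306.1515).
* Y.-T. Siu, *The complex-analyticity of harmonic maps and the strong rigidity of compact Kähler
  manifolds*, Ann. of Math. 112 (1980), 73–111.
* Y.-T. Siu, *Strong rigidity for Kähler manifolds and the construction of bounded holomorphic
  functions*, in: Discrete Groups in Geometry and Analysis (papers in honor of G. D. Mostow),
  Progr. Math. 67, Birkhäuser (1987), §1.
* J.-P. Serre, *GAGA*, Ann. Inst. Fourier 6 (1956), §2 n°5 Prop. 2 (uniqueness of `X^h`).
-/

noncomputable section

open scoped Manifold ContDiff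

namespace Literature.AlgebraicGeometry.HodgeTheory

section HodgeTheory

/-! ### Covering maps: closed image, surjectivity onto a connected base -/

/-- The image of a covering map (in Mathlib's sense, which does not require surjectivity) is
closed: a point with empty fibre has an evenly covered neighbourhood, over which the covering is
trivial with empty fibre. Together with openness (`IsCoveringMap.isOpenMap`) the image is clopen.
[folklore] -/
theorem isClosed_range_of_isCoveringMap {E B : Type*} [TopologicalSpace E] [TopologicalSpace B]
    {f : E → B} (hf : IsCoveringMap f) : IsClosed (Set.range f) := by
  rw [← isOpen_compl_iff, isOpen_iff_forall_mem_open]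
  intro x hx
  obtain ⟨_, U, hxU, hU, -, H, -⟩ := hf x
  refine ⟨U, fun y hy hy' ↦ ?_, hU, hxU⟩
  obtain ⟨e, rfl⟩ := hy'
  exact hx ⟨((H ⟨e, hy⟩).2 : f ⁻¹' {x}).1, ((H ⟨e, hy⟩).2 : f ⁻¹' {x}).2⟩

/-- A covering map from a non-empty space onto a connected space is surjective (its image is a
non-empty clopen set). [folklore] -/
theorem surjective_of_isCoveringMap {E B : Type*} [TopologicalSpace E] [TopologicalSpace B]
    [Nonempty E] [ConnectedSpace B] {f : E → B} (hf : IsCoveringMap f) :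
    Function.Surjective f := by
  have hclopen : IsClopen (Set.range f) :=
    ⟨isClosed_range_of_isCoveringMap hf, hf.isOpenMap.isOpen_range⟩
  rcases isClopen_iff.mp hclopen with h | h
  · exact absurd h (Set.range_nonempty f).ne_empty
  · exact Set.range_eq_univ.mp h

variable {n : ℕ} {X : Motives.SchemeOver ℂ}

/-! ### Ball coverings of a Hodge model -/

namespace HodgeModel

/-- A Hodge model `A` of `X` (the complex manifold `X^an`) is **covered by the ball**: there is a map
`π : ℂⁿ → X^an` (`ℂⁿ = EuclideanSpace ℂ (Fin n)` with its hermitian norm), `ℂ`-differentiable at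
every point of the open unit ball `𝔹ⁿ = {‖z‖ < 1}` and whose restriction to `𝔹ⁿ` is a covering
map. Since `𝔹ⁿ` is simply connected this says that the universal covering of `X^an` is
(biholomorphic to) the ball, i.e. `X^an ≅ Γ \ 𝔹ⁿ` for the deck group `Γ ⊂ Aut(𝔹ⁿ) = PU(n,1)`
(discrete, torsion-free; cocompact when `X^an` is compact) — the rank-one bounded symmetric domain
`U(n,1)/(U(n) × U(1))` "identifies with the unit ball in `ℂⁿ`". The values of `π` off the ball are
irrelevant. [cite: BergeronMillsonMoeglin2016Balls, §1.1] -/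
def IsBallCovered (A : HodgeModel n X) : Prop :=
  ∃ π : EuclideanSpace ℂ (Fin n) → A.carrier,
    (∀ z ∈ Metric.ball (0 : EuclideanSpace ℂ (Fin n)) 1,
      MDifferentiableAt 𝓘(ℂ, EuclideanSpace ℂ (Fin n)) 𝓘(ℂ, A.model) π z) ∧
    IsCoveringMap ((Metric.ball (0 : EuclideanSpace ℂ (Fin n)) 1).restrict π)

/-- Unfolding lemma for `HodgeModel.IsBallCovered`. [cite: BergeronMillsonMoeglin2016Balls, §1.1] -/
theorem isBallCovered_iff (A : HodgeModel n X) :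
    A.IsBallCovered ↔ ∃ π : EuclideanSpace ℂ (Fin n) → A.carrier,
      (∀ z ∈ Metric.ball (0 : EuclideanSpace ℂ (Fin n)) 1,
        MDifferentiableAt 𝓘(ℂ, EuclideanSpace ℂ (Fin n)) 𝓘(ℂ, A.model) π z) ∧
      IsCoveringMap ((Metric.ball (0 : EuclideanSpace ℂ (Fin n)) 1).restrict π) :=
  Iff.rfl

/-- **Transport of a ball covering along a holomorphic homeomorphism of carriers**: if `A` is covered
by the ball via `π` and `h : A.carrier ≃ₜ A'.carrier` is holomorphic, then `A'` is covered by the ball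
via `h ∘ π` (a homeomorphism composed with a covering map is a covering map,
`IsCoveringMap.homeomorph_comp`; holomorphy by the chain rule). [folklore] -/
theorem IsBallCovered.of_homeomorph {A A' : HodgeModel n X} (hA : A.IsBallCovered)
    (h : A.carrier ≃ₜ A'.carrier) (hh : MDifferentiable 𝓘(ℂ, A.model) 𝓘(ℂ, A'.model) h) :
    A'.IsBallCovered := by
  obtain ⟨π, hπ, hcov⟩ := hA
  refine ⟨h ∘ π, fun z hz ↦ (hh (π z)).comp z (hπ z hz), ?_⟩
  have hrestr : (Metric.ball (0 : EuclideanSpace ℂ (Fin n)) 1).restrict (h ∘ π) =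
      h ∘ (Metric.ball (0 : EuclideanSpace ℂ (Fin n)) 1).restrict π := rfl
  rw [hrestr]
  exact hcov.homeomorph_comp h

/-- For a smooth projective `X`, a covering of the carrier `X^an` of a Hodge model by the ball is
**surjective**: `X^an` is connected (`HodgeModel.connectedSpace_carrier`, SGA1 XII Prop. 2.4), the
ball is non-empty, and the image of a covering map is clopen. [folklore] -/
theorem surjective_ballRestrict (A : HodgeModel n X) (hX : Motives.IsSmoothProjective n X)
    {π : EuclideanSpace ℂ (Fin n) → A.carrier}
    (hπ : IsCoveringMap ((Metric.ball (0 : EuclideanSpace ℂ (Fin n)) 1).restrict π)) :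
    Function.Surjective ((Metric.ball (0 : EuclideanSpace ℂ (Fin n)) 1).restrict π) := by
  haveI := A.connectedSpace_carrier hX
  haveI : Nonempty ↥(Metric.ball (0 : EuclideanSpace ℂ (Fin n)) 1) :=
    ⟨⟨0, Metric.mem_ball_self one_pos⟩⟩
  exact surjective_of_isCoveringMap hπ

/-- For a smooth projective `X`, a covering of `X^an` by the ball is a **quotient map**: `X^an`
carries the quotient topology of `𝔹ⁿ` (it is the orbit space of the deck group). [folklore] -/
theorem isQuotientMap_ballRestrict (A : HodgeModel n X) (hX : Motives.IsSmoothProjective n X)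
    {π : EuclideanSpace ℂ (Fin n) → A.carrier}
    (hπ : IsCoveringMap ((Metric.ball (0 : EuclideanSpace ℂ (Fin n)) 1).restrict π)) :
    Topology.IsQuotientMap ((Metric.ball (0 : EuclideanSpace ℂ (Fin n)) 1).restrict π) :=
  hπ.isQuotientMap (A.surjective_ballRestrict hX hπ)

/-- Local copy (to keep the import closure small) of the tree's `HodgeModel.compactSpace_carrier`
(file `HypersurfaceHolomorphicForms`): the carrier of a Hodge model of a smooth projective `X` is
compact — `X → Spec ℂ` is proper, so `X(ℂ)` is compact (GAGA §2 n°7 Prop. 6, the tree's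
`Motives.compactSpace_algPoints_of_isProper_holds`), and the comparison map is a homeomorphism.
[cite: SerreGAGA1956, §2 n°7 Prop. 6] -/
private theorem compactSpace_carrier_of_isSmoothProjective (A : HodgeModel n X)
    (hX : Motives.IsSmoothProjective n X) : CompactSpace A.carrier := by
  haveI : AlgebraicGeometry.IsProper X.hom := Motives.IsSmoothProjective.isProper_holds hX
  haveI : CompactSpace (Motives.ComplexPoints X) :=
    Motives.compactSpace_algPoints_of_isProper_holds X ℂ
  exact A.isAnalytification.homeomorph.symm.compactSpace

/-- For a smooth projective `X`, the carrier of a ball-covered Hodge model is a **compact** space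
covered by the ball — the "compact" in "compact ball quotient" (`X` proper, GAGA §2 n°7 Prop. 6;
cf. the tree's `HodgeModel.compactSpace_carrier`). [cite: SerreGAGA1956, §2 n°7 Prop. 6] -/
theorem IsBallCovered.compactSpace_carrier {A : HodgeModel n X} (_hA : A.IsBallCovered)
    (hX : Motives.IsSmoothProjective n X) : CompactSpace A.carrier :=
  A.compactSpace_carrier_of_isSmoothProjective hX

end HodgeModel

/-! ### Compact ball quotients -/

/-- **`X` is a compact ball quotient** (of dimension `n`): some Hodge model `X^an` of the smooth
`ℂ`-scheme `X` is covered holomorphically by the unit ball `𝔹ⁿ ⊂ ℂⁿ` (hermitian norm) — there are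
`A : HodgeModel n X` and `π : ℂⁿ → A.carrier`, `ℂ`-differentiable on `𝔹ⁿ`, whose restriction to
`𝔹ⁿ` is a covering map. For smooth projective `X` (the intended use, together with
`Motives.IsSmoothProjective n X`): equivalently EVERY Hodge model is so covered
(`IsCompactBallQuotient.isBallCovered`, by uniqueness of the analytification); the carrier is
compact and connected, so the covering is onto (`HodgeModel.surjective_ballRestrict`) and — `𝔹ⁿ`
being simply connected — `X^an ≅ Γ \ 𝔹ⁿ` with `Γ ⊂ PU(n,1) = Aut(𝔹ⁿ)` the deck group, discrete,
torsion-free and cocompact: the compact quotients `S(Γ) = Γ \ X`, "`X` identifies with the unit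
ball in `ℂᵖ`", of Bergeron–Millson–Moeglin, and the rank-one case of the compact quotients of
bounded symmetric domains in Siu's strong rigidity theorem. Without connectedness of `X^an` the bare
predicate only says that one connected component of `X^an` is uniformised by `𝔹ⁿ` (module
docstring). Spelled verbatim as the inline hypothesis of the items of route `SiuRepresentability`
(`isCompactBallQuotient_iff` is `Iff.rfl`).
[cite: BergeronMillsonMoeglin2016Balls, §1.1] -/
def IsCompactBallQuotient (n : ℕ) (X : Motives.SchemeOver ℂ) : Prop :=
  ∃ (A : HodgeModel n X) (π : EuclideanSpace ℂ (Fin n) → A.carrier),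
    (∀ z ∈ Metric.ball (0 : EuclideanSpace ℂ (Fin n)) 1,
      MDifferentiableAt 𝓘(ℂ, EuclideanSpace ℂ (Fin n)) 𝓘(ℂ, A.model) π z) ∧
    IsCoveringMap ((Metric.ball (0 : EuclideanSpace ℂ (Fin n)) 1).restrict π)

/-- Unfolding lemma: `IsCompactBallQuotient n X` is, verbatim, the inline hypothesis "some Hodge
model of `X` is covered holomorphically by the unit ball of `ℂⁿ`" of the route items.
[cite: BergeronMillsonMoeglin2016Balls, §1.1] -/
theorem isCompactBallQuotient_iff (n : ℕ) (X : Motives.SchemeOver ℂ) :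
    IsCompactBallQuotient n X ↔
      ∃ (A : HodgeModel n X) (π : EuclideanSpace ℂ (Fin n) → A.carrier),
        (∀ z ∈ Metric.ball (0 : EuclideanSpace ℂ (Fin n)) 1,
          MDifferentiableAt 𝓘(ℂ, EuclideanSpace ℂ (Fin n)) 𝓘(ℂ, A.model) π z) ∧
        IsCoveringMap ((Metric.ball (0 : EuclideanSpace ℂ (Fin n)) 1).restrict π) :=
  Iff.rfl

/-- `IsCompactBallQuotient n X` says exactly that some Hodge model of `X` is ball-covered.
[cite: BergeronMillsonMoeglin2016Balls, §1.1] -/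
theorem isCompactBallQuotient_iff_exists_isBallCovered (n : ℕ) (X : Motives.SchemeOver ℂ) :
    IsCompactBallQuotient n X ↔ ∃ A : HodgeModel n X, A.IsBallCovered :=
  Iff.rfl

/-- A ball-covered Hodge model witnesses that `X` is a compact ball quotient.
[cite: BergeronMillsonMoeglin2016Balls, §1.1] -/
theorem HodgeModel.IsBallCovered.isCompactBallQuotient {A : HodgeModel n X} (hA : A.IsBallCovered) :
    IsCompactBallQuotient n X :=
  ⟨A, hA⟩

namespace IsCompactBallQuotient

/-- A compact ball quotient has a Hodge model (trivially, from the witness). [folklore] -/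
theorem nonempty_hodgeModel (hq : IsCompactBallQuotient n X) : Nonempty (HodgeModel n X) :=
  hq.elim fun A _ ↦ ⟨A⟩

/-- **Independence of the Hodge model.** If the smooth projective `X` is a compact ball quotient,
then EVERY Hodge model of `X` is covered holomorphically by the ball: two Hodge models differ by a
biholomorphism over `X(ℂ)` (`HodgeModel.exists_biholomorph`, the uniqueness of the analytification,
Serre GAGA §2 n°5 Prop. 2, proved in the tree), along which a ball covering is transported
(`HodgeModel.IsBallCovered.of_homeomorph`). [cite: SerreGAGA1956, §2 n°5 Prop. 2 (unicité de X^h)] -/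
theorem isBallCovered (hX : Motives.IsSmoothProjective n X) (hq : IsCompactBallQuotient n X)
    (A' : HodgeModel n X) : A'.IsBallCovered := by
  obtain ⟨A, hA⟩ := (isCompactBallQuotient_iff_exists_isBallCovered n X).mp hq
  obtain ⟨h, hh, -, -⟩ := HodgeModel.exists_biholomorph hX A A'
  exact hA.of_homeomorph h hh

/-- For a smooth projective compact ball quotient and ANY Hodge model `A`, there is a holomorphic
covering `π : 𝔹ⁿ → A.carrier` which is moreover surjective (the form in which "`X^an = Γ \ 𝔹ⁿ`" is
consumed). [cite: BergeronMillsonMoeglin2016Balls, §1.1] -/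
theorem exists_covering (hX : Motives.IsSmoothProjective n X) (hq : IsCompactBallQuotient n X)
    (A : HodgeModel n X) :
    ∃ π : EuclideanSpace ℂ (Fin n) → A.carrier,
      (∀ z ∈ Metric.ball (0 : EuclideanSpace ℂ (Fin n)) 1,
        MDifferentiableAt 𝓘(ℂ, EuclideanSpace ℂ (Fin n)) 𝓘(ℂ, A.model) π z) ∧
      IsCoveringMap ((Metric.ball (0 : EuclideanSpace ℂ (Fin n)) 1).restrict π) ∧
      Function.Surjective ((Metric.ball (0 : EuclideanSpace ℂ (Fin n)) 1).restrict π) := by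
  obtain ⟨π, hπ, hcov⟩ := hq.isBallCovered hX A
  exact ⟨π, hπ, hcov, A.surjective_ballRestrict hX hcov⟩

/-- The carrier of every Hodge model of a smooth projective compact ball quotient is compact and
connected (so the deck group of the ball covering is cocompact). [cite: SerreGAGA1956, §2 n°7 Prop. 6] -/
theorem compactSpace_and_connectedSpace (hX : Motives.IsSmoothProjective n X)
    (hq : IsCompactBallQuotient n X) (A : HodgeModel n X) :
    CompactSpace A.carrier ∧ ConnectedSpace A.carrier :=
  ⟨(hq.isBallCovered hX A).compactSpace_carrier hX, A.connectedSpace_carrier hX⟩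

end IsCompactBallQuotient

/-- **`∃` and `∀` over Hodge models agree**: for smooth projective `X`, being a compact ball quotient
is equivalent to "a Hodge model exists and every Hodge model is covered holomorphically by the
ball". [cite: SerreGAGA1956, §2 n°5 Prop. 2 (unicité de X^h)] -/
theorem isCompactBallQuotient_iff_forall (hX : Motives.IsSmoothProjective n X) :
    IsCompactBallQuotient n X ↔
      Nonempty (HodgeModel n X) ∧ ∀ A : HodgeModel n X, A.IsBallCovered := by
  refine ⟨fun hq ↦ ⟨hq.nonempty_hodgeModel, hq.isBallCovered hX⟩, ?_⟩
  rintro ⟨⟨A⟩, hall⟩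
  exact (hall A).isCompactBallQuotient

/-- In the presence of a preferred Hodge model `A` (e.g. the one produced by
`HodgeModel`-existence), `X` is a compact ball quotient iff THAT model is ball-covered.
[cite: SerreGAGA1956, §2 n°5 Prop. 2 (unicité de X^h)] -/
theorem isCompactBallQuotient_iff_isBallCovered (hX : Motives.IsSmoothProjective n X)
    (A : HodgeModel n X) : IsCompactBallQuotient n X ↔ A.IsBallCovered :=
  ⟨fun hq ↦ hq.isBallCovered hX A, fun hA ↦ hA.isCompactBallQuotient⟩

end HodgeTheory

end Literature.AlgebraicGeometry.HodgeTheory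

end
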